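import Summits.NavierStokesRegularity.FluidComputer.ClayBlowupForcedL3Local
import Summits.NavierStokesRegularity.FluidComputer.ClayBlowupLocalTypeILiouville
import Summits.NavierStokesRegularity.FluidComputer.ClayBlowupLocalAxisDecay
import Summits.NavierStokesRegularity.FluidComputer.ClayBlowupOfBreakdown
import HarnessLib

/-!
# THE PORTRAIT OF A SINGULAR POINT OF A CLAY BLOW-UP, WITH THE CLAY FORCE

Cell `ns-blowup`, seat `ns-blowup-ecbridge-2` (g11; the E–C endpoint theory seat). LABEL: E–C typing
(KERNEL — no named fact; row (3) takes the tree conjecture `LiouvilleConjectureNS` as a hypothesis).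
WHAT THIS IS NOT: not Navier–Stokes evidence — a necessary condition on the TYPE `ClayBlowup ν` with
its Clay force; no inhabitant is claimed. Companion memo:
`run/shared/lean/pub/ns-blowup/ecbridge2/ECBRIDGE-2-MEMO-10.md`.

## Content

One name for the LOCAL rows of g11 at a point `x₁` of the singular slice
`S_T = {x | ¬ IsBackwardBoundedAt u T x}` (which is non-empty, `exists_not_isBackwardBoundedAt`, and
`ℋ¹`-null) of a Clay blow-up WITH its force, every `ν > 0`:

* **`ClayBlowup.singularPoint_portrait_forced`** — (1) `L³` CONCENTRATES at `x₁`
  (`L3_concentration_forced`); (2) LOCAL GIGA–MIURA: a Type I bound on a ball around `x₁` forces the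
  vorticity directions to be NOT continuously aligned in that ball
  (`not_local_continuousAlignment_of_localTypeI_forced`); (3) under KNSS's Liouville conjecture (L) NO
  local Type I bound holds on any ball around `x₁` (`not_localTypeI_of_liouvilleConjecture`); (4) for
  axisymmetric datum and force, `r‖u‖` is unbounded in every `(t₀, T) × B(x₁, r₀)`
  (`exists_local_cylRadius_mul_norm_gt`). The blow-up LIMIT at `x₁` itself (a nontrivial bounded
  ancient mild solution of the unforced equations, attained locally uniformly) is
  `exists_local_zoom_limit_uniform` (stated at the normalised viscosity `1`).
* `ClayBlowup.exists_singularPoint_portrait_forced` — there IS such a point; `DesignedBlowup` twin;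
  `breakdownR3_singularPoint_portrait` — the (C)-reading.

References: Escauriaza–Seregin–Šverák 2003 Thm 1.4; Albritton–Barker 2019 Thm 1.2; Giga–Miura 2011
Thm 1.1; Koch–Nadirashvili–Seregin–Šverák 2009 §1, Thm 6.1 [cite: EscauriazaSereginSverak2003, Thm. 1.4]
[cite: GigaMiura2011, Thm 1.1] [cite: KochNadirashviliSereginSverak2009, §1 and Thm 6.1]
[cite: FeffermanClay2006, (C)].
-/

noncomputable section

namespace Summit.NavierStokesRegularity.FluidComputer

open Set MeasureTheory Filter Topology Function Metric
open scoped ENNReal NNReal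
open Literature.Analysis Literature.Analysis.FluidPDE
open Summit.NavierStokesRegularity.NavierStokesRegularity

namespace ClayBlowup

variable {ν : ℝ} (X : ClayBlowup ν)

/-- **THE PORTRAIT OF A SINGULAR POINT, WITH THE CLAY FORCE** (`ν > 0`, ANY Clay force; no named
fact; (3) conditional on (L) as a hypothesis): at a point `x₁` which is not backward bounded at `T` —
(1) local `L³` concentration; (2) local Giga–Miura; (3) (L) ⇒ no local Type I bound; (4) axisymmetric
designs: `r‖u‖` locally unbounded. Cite this one name for the local checklist.
[cite: EscauriazaSereginSverak2003, Thm. 1.4] [cite: GigaMiura2011, Thm 1.1]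
[cite: KochNadirashviliSereginSverak2009, §1 and Thm 6.1] -/
theorem singularPoint_portrait_forced (hν : 0 < ν) {x₁ : EuclideanSpace ℝ (Fin 3)}
    (hx₁ : ¬ IsBackwardBoundedAt X.u X.T x₁) :
    (∀ r : ℝ, 0 < r → r ^ 2 ≤ X.T → ∀ C : ℝ≥0,
      ∃ t ∈ Ioo (X.T - r ^ 2) X.T, (C : ℝ≥0∞) < ∫⁻ x in ball x₁ r, ‖X.u t x‖ₑ ^ 3) ∧
    (∀ r₀ : ℝ, 0 < r₀ →
      (∃ C : ℝ, ∀ᶠ t in 𝓝[<] X.T, ∀ x ∈ ball x₁ r₀, ‖X.u t x‖ ≤ C / Real.sqrt (X.T - t)) →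
      ∀ d : ℝ, 0 < d → ∀ η : ℝ → ℝ, MonotoneOn η (Ici 0) → ContinuousOn η (Ici 0) → η 0 = 0 →
        ∃ t ∈ Ioo 0 X.T, ∃ x ∈ ball x₁ r₀, ∃ x' ∈ ball x₁ r₀,
          d < ‖curl (X.u t) x‖ ∧ d < ‖curl (X.u t) x'‖ ∧
            η ‖x - x'‖ <
              ‖vorticityDirection (curl (X.u t)) x - vorticityDirection (curl (X.u t)) x'‖) ∧
    (Summit.NavierStokesRegularity.NavierStokesRegularity.LiouvilleConjectureNS →
      ∀ r₀ : ℝ, 0 < r₀ → ∀ C : ℝ,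
        ¬ ∀ᶠ t in 𝓝[<] X.T, ∀ x ∈ ball x₁ r₀, ‖X.u t x‖ ≤ C / Real.sqrt (X.T - t)) ∧
    (IsAxisymmetric (X.u 0) → (∀ t ∈ Ico 0 X.T, IsAxisymmetric (X.f t)) →
      ∀ r₀ : ℝ, 0 < r₀ → ∀ t₀ : ℝ, t₀ < X.T → ∀ C : ℝ,
        ∃ t ∈ Ioo t₀ X.T, ∃ x ∈ ball x₁ r₀, C < cylRadius x * ‖X.u t x‖) :=
  ⟨fun _ hr hrT C => X.L3_concentration_forced hν hx₁ hr hrT C,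
    fun _ hr₀ hI _ hd _ hηm hηc hη0 =>
      X.not_local_continuousAlignment_of_localTypeI_forced hν hx₁ hr₀ hI hd hηm hηc hη0,
    fun hL _ hr₀ C => X.not_localTypeI_of_liouvilleConjecture hν hL hx₁ hr₀ C,
    fun h0A hfA _ hr₀ _ ht₀ C => X.exists_local_cylRadius_mul_norm_gt hν h0A hfA hx₁ hr₀ ht₀ C⟩

/-- **Every Clay blow-up, with its force, HAS a singular point with this portrait** (`ν > 0`):
`exists_not_isBackwardBoundedAt` + `singularPoint_portrait_forced`.
[cite: EscauriazaSereginSverak2003, Thm. 1.4] [cite: GigaMiura2011, Thm 1.1]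
[cite: KochNadirashviliSereginSverak2009, §1 and Thm 6.1] -/
theorem exists_singularPoint_portrait_forced (hν : 0 < ν) :
    ∃ x₁ : EuclideanSpace ℝ (Fin 3), ¬ IsBackwardBoundedAt X.u X.T x₁ ∧
      (∀ r : ℝ, 0 < r → r ^ 2 ≤ X.T → ∀ C : ℝ≥0,
        ∃ t ∈ Ioo (X.T - r ^ 2) X.T, (C : ℝ≥0∞) < ∫⁻ x in ball x₁ r, ‖X.u t x‖ₑ ^ 3) ∧
      (∀ r₀ : ℝ, 0 < r₀ →
        (∃ C : ℝ, ∀ᶠ t in 𝓝[<] X.T, ∀ x ∈ ball x₁ r₀, ‖X.u t x‖ ≤ C / Real.sqrt (X.T - t)) →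
        ∀ d : ℝ, 0 < d → ∀ η : ℝ → ℝ, MonotoneOn η (Ici 0) → ContinuousOn η (Ici 0) → η 0 = 0 →
          ∃ t ∈ Ioo 0 X.T, ∃ x ∈ ball x₁ r₀, ∃ x' ∈ ball x₁ r₀,
            d < ‖curl (X.u t) x‖ ∧ d < ‖curl (X.u t) x'‖ ∧
              η ‖x - x'‖ <
                ‖vorticityDirection (curl (X.u t)) x - vorticityDirection (curl (X.u t)) x'‖) ∧
      (Summit.NavierStokesRegularity.NavierStokesRegularity.LiouvilleConjectureNS →
        ∀ r₀ : ℝ, 0 < r₀ → ∀ C : ℝ,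
          ¬ ∀ᶠ t in 𝓝[<] X.T, ∀ x ∈ ball x₁ r₀, ‖X.u t x‖ ≤ C / Real.sqrt (X.T - t)) ∧
      (IsAxisymmetric (X.u 0) → (∀ t ∈ Ico 0 X.T, IsAxisymmetric (X.f t)) →
        ∀ r₀ : ℝ, 0 < r₀ → ∀ t₀ : ℝ, t₀ < X.T → ∀ C : ℝ,
          ∃ t ∈ Ioo t₀ X.T, ∃ x ∈ ball x₁ r₀, C < cylRadius x * ‖X.u t x‖) := by
  obtain ⟨x₁, hx₁⟩ := X.exists_not_isBackwardBoundedAt hν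
  exact ⟨x₁, hx₁, X.singularPoint_portrait_forced hν hx₁⟩

end ClayBlowup

/-- **The portrait of a singular point of a designed blow-up, with its force** (through
`toClayBlowup`). [cite: EscauriazaSereginSverak2003, Thm. 1.4] [cite: GigaMiura2011, Thm 1.1]
[cite: KochNadirashviliSereginSverak2009, §1 and Thm 6.1] -/
theorem DesignedBlowup.singularPoint_portrait_forced {ν : ℝ} (D : DesignedBlowup ν) (hν : 0 < ν)
    {x₁ : EuclideanSpace ℝ (Fin 3)} (hx₁ : ¬ IsBackwardBoundedAt D.u D.T x₁) :
    (∀ r : ℝ, 0 < r → r ^ 2 ≤ D.T → ∀ C : ℝ≥0,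
      ∃ t ∈ Ioo (D.T - r ^ 2) D.T, (C : ℝ≥0∞) < ∫⁻ x in ball x₁ r, ‖D.u t x‖ₑ ^ 3) ∧
    (∀ r₀ : ℝ, 0 < r₀ →
      (∃ C : ℝ, ∀ᶠ t in 𝓝[<] D.T, ∀ x ∈ ball x₁ r₀, ‖D.u t x‖ ≤ C / Real.sqrt (D.T - t)) →
      ∀ d : ℝ, 0 < d → ∀ η : ℝ → ℝ, MonotoneOn η (Ici 0) → ContinuousOn η (Ici 0) → η 0 = 0 →
        ∃ t ∈ Ioo 0 D.T, ∃ x ∈ ball x₁ r₀, ∃ x' ∈ ball x₁ r₀,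
          d < ‖curl (D.u t) x‖ ∧ d < ‖curl (D.u t) x'‖ ∧
            η ‖x - x'‖ <
              ‖vorticityDirection (curl (D.u t)) x - vorticityDirection (curl (D.u t)) x'‖) ∧
    (Summit.NavierStokesRegularity.NavierStokesRegularity.LiouvilleConjectureNS →
      ∀ r₀ : ℝ, 0 < r₀ → ∀ C : ℝ,
        ¬ ∀ᶠ t in 𝓝[<] D.T, ∀ x ∈ ball x₁ r₀, ‖D.u t x‖ ≤ C / Real.sqrt (D.T - t)) ∧
    (IsAxisymmetric (D.u 0) → (∀ t ∈ Ico 0 D.T, IsAxisymmetric (D.f t)) →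
      ∀ r₀ : ℝ, 0 < r₀ → ∀ t₀ : ℝ, t₀ < D.T → ∀ C : ℝ,
        ∃ t ∈ Ioo t₀ D.T, ∃ x ∈ ball x₁ r₀, C < cylRadius x * ‖D.u t x‖) :=
  D.toClayBlowup.singularPoint_portrait_forced hν hx₁

/-- **(C)-READING OF THE SINGULAR-POINT PORTRAIT**: if Fefferman's (C) holds then at every `ν > 0`
there are a Clay blow-up and a point of its singular slice with the four-row portrait above (row (3)
under (L)). [cite: FeffermanClay2006, (C)] [cite: KochNadirashviliSereginSverak2009, §1 and Thm 6.1] -/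
theorem breakdownR3_singularPoint_portrait
    (h : Summit.NavierStokesRegularity.NavierStokesRegularity.NavierStokesBreakdownR3) {ν : ℝ}
    (hν : 0 < ν) :
    ∃ X : ClayBlowup ν, ∃ x₁ : EuclideanSpace ℝ (Fin 3), ¬ IsBackwardBoundedAt X.u X.T x₁ ∧
      (∀ r : ℝ, 0 < r → r ^ 2 ≤ X.T → ∀ C : ℝ≥0,
        ∃ t ∈ Ioo (X.T - r ^ 2) X.T, (C : ℝ≥0∞) < ∫⁻ x in ball x₁ r, ‖X.u t x‖ₑ ^ 3) ∧
      (Summit.NavierStokesRegularity.NavierStokesRegularity.LiouvilleConjectureNS →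
        ∀ r₀ : ℝ, 0 < r₀ → ∀ C : ℝ,
          ¬ ∀ᶠ t in 𝓝[<] X.T, ∀ x ∈ ball x₁ r₀, ‖X.u t x‖ ≤ C / Real.sqrt (X.T - t)) := by
  obtain ⟨X⟩ := forall_nonempty_clayBlowup_of_breakdownR3 h ν hν
  obtain ⟨x₁, hx₁, h1, -, h3, -⟩ := X.exists_singularPoint_portrait_forced hν
  exact ⟨X, x₁, hx₁, h1, h3⟩

end Summit.NavierStokesRegularity.FluidComputer

end
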